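import Literature.AnabelianGeometry.AbsoluteAnabelian.AbsTopIII.ReconstructionRigidityConsequences
import Mathlib.Algebra.Field.ULift
import Mathlib.Algebra.Algebra.Rat
import HarnessLib

/-!
# [AbsTopIII] Cor. 1.10 (iii) relative to a model: the instance form FROM its bi-anabelian shadow

S. Mochizuki, *Topics in Absolute Anabelian Geometry III: global reconstruction algorithms*
[MochizukiAbsTopIII2015], Cor. 1.10 (iii) pp. 43–44 ("there exists a functorial 'group-theoretic'
algorithm for reconstructing the function field `K_X` of `X` from the profinite group `Π_X`", steps
(e)–(h); "the asserted 'functoriality' is with respect to arbitrary open injective homomorphisms of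
profinite groups", p. 44), Rmk. 1.9.8 pp. 40–41 ("if one is allowed in one's algorithms to introduce
some fixed reference model [...], then the task of establishing an 'algorithm' may, in effect, be
reduced to 'comparison with the fixed reference model', i.e., reduced to some sort of result in
'bi-anabelian geometry'").

Cell abc-iut, row «COR110iii-INSTANCE-CENSUS→CLOSER» (abc-iut-L4-lead RULING #8a), seat abc-iut-w5-d058
(gen 8).  PROOF-ONLY companion of `AbsTopIII/Reconstruction.lean` (abc-iut-L4-t1, the typed row F-0396
`Cor_1_10_iii M`) and of `AbsTopIII/ReconstructionRigidityConsequences.lean` (abc-iut-f-088: the three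
NECESSARY conditions `Cor_1_10_iii.exists_ringEquiv_compatible`,
`Cor_1_10_iii.nonempty_ringHom_functionField_of_isOpenInjective`, `Cor_1_10_iii.exists_closedPointDecomp_eq`);
no `def`, no `instance`, no `structure`, no `Prop` fact.

THE CLOSER.  `cor_1_10_iii_of_biAnabelian`: at ANY interface `M : CurveModel`, the instance form
`Cor_1_10_iii M` FOLLOWS from four explicit hypotheses (theorem binders, consumed BY NAME by whoever
supplies them at a genuine model):
* (B1) ISOM-RIGIDITY — for strictly-Belyi inputs `X`, `Y` over MLF's, every isomorphism of extensions
  `M.ext X ≅ M.ext Y` is covered by a compatible pair of isomorphisms `k_X ≃+* k_Y`, `K_X ≃+* K_Y`;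
* (B2) OPEN-HOM FUNCTORIALITY — every open injective homomorphism `M.ext X ⟶ M.ext Y` between such
  inputs is covered by SOME field embedding `K_Y →+* K_X`;
* (B3) the closed-point decomposition data factor through `X ↦ M.ext X`;
* (B4) MODEL CLOSURE — every abstract extension admitting an open injective homomorphism INTO the
  extension of such an input is itself isomorphic to the extension of such an input (at the étale-`π₁`
  model: open sub-extensions of `Π_X` are the `Π_Y` of finite étale coverings `Y → X ×_k k′`, which are
  again of strictly Belyi type over an MLF).
(B1)–(B3) are NECESSARY (abc-iut-f-088's three theorems), so modulo the closure law (B4) the typed row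
reads «`Cor_1_10_iii M` ⟺ (B1) ∧ (B2) ∧ (B3)» (`cor_1_10_iii_iff_biAnabelian`).  The construction: the
algorithm record sends an abstract extension to the fields of a CHOSEN input curve of its isomorphism
class (junk `ℚ ⊆ ℚ` off those classes), transports along isomorphisms by casts along the equality of
the chosen curves, and along open injections by (B2) — i.e. exactly the "comparison with a fixed
reference model" of Rmk. 1.9.8: the typed functoriality fields (`map` on the two fields only, `comap`
law-free off isomorphisms) carry no mono-anabelian content beyond (B1)–(B3).

HONEST LABEL.  A statement about OUR typing of the row (what a supplier of `Cor_1_10_iii M` must and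
need only deliver); (B1)/(B2) at the étale-`π₁` model are the absolute Isom-type and open-Hom-type rigidity of
strictly-Belyi hyperbolic orbicurves over MLF's — published bi-anabelian theorems outside the tree
(plan/FOUNDATIONS.md row 12), NOT proved here and NOT assumed as facts.  Typed ≠ proved; nothing here
bears on the disputed [IUTchIII] Cor. 3.12; no side taken on any author.
-/

noncomputable section

open scoped Classical Pointwise

namespace Literature.AnabelianGeometry.AbsoluteAnabelian

open CategoryTheory

universe u

namespace FundamentalExtension

variable {E F K : FundamentalExtension.{u}}

/-- The `Π`-components of an isomorphism of extensions are mutually inverse (left).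
[cite: MochizukiAbsTopIII2015, Thm 1.9 p.38] -/
theorem iso_inv_arith_apply (e : E ≅ F) (x : E.arith) : e.inv.arith (e.hom.arith x) = x :=
  congrArg (fun f => Hom.arith f x) e.hom_inv_id

/-- The `Π`-components of an isomorphism of extensions are mutually inverse (right).
[cite: MochizukiAbsTopIII2015, Thm 1.9 p.38] -/
theorem iso_hom_arith_apply (e : E ≅ F) (y : F.arith) : e.hom.arith (e.inv.arith y) = y :=
  congrArg (fun f => Hom.arith f y) e.inv_hom_id

/-- The `G`-components of an isomorphism of extensions are mutually inverse (left).
[cite: MochizukiAbsTopIII2015, Thm 1.9 p.38] -/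
theorem iso_inv_gal_apply (e : E ≅ F) (x : E.gal) : e.inv.gal (e.hom.gal x) = x :=
  congrArg (fun f => Hom.gal f x) e.hom_inv_id

/-- The `G`-components of an isomorphism of extensions are mutually inverse (right).
[cite: MochizukiAbsTopIII2015, Thm 1.9 p.38] -/
theorem iso_hom_gal_apply (e : E ≅ F) (y : F.gal) : e.hom.gal (e.inv.gal y) = y :=
  congrArg (fun f => Hom.gal f y) e.inv_hom_id

/-- An isomorphism of extensions is an open injective homomorphism.
[cite: MochizukiAbsTopIII2015, Thm 1.9 p.38] -/
theorem Hom.IsOpenInjective.of_iso (e : E ≅ F) : e.hom.IsOpenInjective where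
  arith_injective := Function.LeftInverse.injective (iso_inv_arith_apply e)
  isOpen_range_arith := by
    rw [(Function.RightInverse.surjective (iso_hom_arith_apply e)).range_eq]; exact isOpen_univ
  gal_injective := Function.LeftInverse.injective (iso_inv_gal_apply e)
  isOpen_range_gal := by
    rw [(Function.RightInverse.surjective (iso_hom_gal_apply e)).range_eq]; exact isOpen_univ

/-- Open injective homomorphisms of extensions are stable under composition (a continuous injection
of profinite groups with open image is an open embedding).
[cite: MochizukiAbsTopIII2015, Thm 1.9 p.38] -/
theorem Hom.IsOpenInjective.comp {f : E ⟶ F} {g : F ⟶ K} (hf : f.IsOpenInjective)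
    (hg : g.IsOpenInjective) : (f ≫ g).IsOpenInjective where
  arith_injective := by
    simpa using hg.arith_injective.comp hf.arith_injective
  isOpen_range_arith := by
    have hemb : Topology.IsOpenEmbedding g.arith :=
      ⟨(g.arith.continuous.isClosedEmbedding hg.arith_injective).isEmbedding, hg.isOpen_range_arith⟩
    have : Set.range (f ≫ g).arith = g.arith '' Set.range f.arith :=
      Set.range_comp (⇑g.arith) (⇑f.arith)
    rw [this]
    exact hemb.isOpenMap _ hf.isOpen_range_arith
  gal_injective := by
    simpa using hg.gal_injective.comp hf.gal_injective
  isOpen_range_gal := by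
    have hemb : Topology.IsOpenEmbedding g.gal :=
      ⟨(g.gal.continuous.isClosedEmbedding hg.gal_injective).isEmbedding, hg.isOpen_range_gal⟩
    have : Set.range (f ≫ g).gal = g.gal '' Set.range f.gal :=
      Set.range_comp (⇑g.gal) (⇑f.gal)
    rw [this]
    exact hemb.isOpenMap _ hf.isOpen_range_gal

end FundamentalExtension

namespace AbsTopIII

variable (M : CurveModel.{u})

/-- **[AbsTopIII] Cor. 1.10 (iii) relative to a model, FROM ITS BI-ANABELIAN SHADOW.**  At any
interface `M`, the instance form `Cor_1_10_iii M` ("some functorial group-theoretic algorithm record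
reconstructs `k ⊆ K_X` and the closed-point decomposition groups on every strictly-Belyi input over an
MLF") follows from: (B1) `hIso` — isomorphic extensions of strictly-Belyi MLF inputs are covered by
compatible isomorphisms of the pairs `k ⊆ K_X`; (B2) `hHom` — open injective homomorphisms between such
extensions are covered by field embeddings `K_Y →+* K_X`; (B3) `hPt` — the closed-point decomposition
data factor through `X ↦ M.ext X`; (B4) `hCov` — an abstract extension with an open injective
homomorphism into the extension of such an input is isomorphic to the extension of such an input.
The algorithm record: an extension goes to the fields of a CHOSEN input of its isomorphism class
(`ℚ ⊆ ℚ` off those classes); isomorphisms act by casts along the equality of the chosen inputs, open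
injections by (B2) ("comparison with a fixed reference model", Rmk. 1.9.8).  (B1)–(B3) are necessary
(`Cor_1_10_iii.exists_ringEquiv_compatible`, `…nonempty_ringHom_functionField_of_isOpenInjective`,
`…exists_closedPointDecomp_eq`, abc-iut-f-088).  Nothing mono-anabelian is used or obtained.
[cite: MochizukiAbsTopIII2015, Cor 1.10 (iii) p.43] -/
theorem cor_1_10_iii_of_biAnabelian
    (hIso : ∀ X Y : M.Curve, M.IsCor110Input X → M.IsStrictlyBelyiType X →
      M.IsCor110Input Y → M.IsStrictlyBelyiType Y → ∀ _ : M.ext X ≅ M.ext Y,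
      ∃ (eb : M.base X ≃+* M.base Y) (ef : M.FunctionField X ≃+* M.FunctionField Y),
        ∀ c, ef (algebraMap (M.base X) (M.FunctionField X) c) =
          algebraMap (M.base Y) (M.FunctionField Y) (eb c))
    (hHom : ∀ X Y : M.Curve, M.IsCor110Input X → M.IsStrictlyBelyiType X →
      M.IsCor110Input Y → M.IsStrictlyBelyiType Y → ∀ f : M.ext X ⟶ M.ext Y, f.IsOpenInjective →
      Nonempty (M.FunctionField Y →+* M.FunctionField X))
    (hPt : ∃ S : ∀ E : FundamentalExtension.{u}, Set (Subgroup E.arith),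
      ∀ X : M.Curve, M.IsCor110Input X → M.IsStrictlyBelyiType X →
        {D | ∃ (x : M.Point X) (g : (M.ext X).arith), D = MulAut.conj g • M.decomp X x} =
          S (M.ext X))
    (hCov : ∀ (E : FundamentalExtension.{u}) (Y : M.Curve), M.IsCor110Input Y →
      M.IsStrictlyBelyiType Y → ∀ f : E ⟶ M.ext Y, f.IsOpenInjective →
        ∃ X : M.Curve, M.IsCor110Input X ∧ M.IsStrictlyBelyiType X ∧ Nonempty (E ≅ M.ext X)) :
    Cor_1_10_iii M := by
  classical
  obtain ⟨S, hS⟩ := hPt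
  -- the class predicate of an abstract extension: "isomorphic to the extension of the pinned input X"
  let Q : FundamentalExtension.{u} → M.Curve → Prop := fun E X =>
    (M.IsCor110Input X ∧ M.IsStrictlyBelyiType X) ∧ Nonempty (E ≅ M.ext X)
  -- the CHOSEN reference input of the isomorphism class (none off the pinned classes)
  let rep : FundamentalExtension.{u} → Option M.Curve := fun E =>
    if h : ∃ X, Q E X then some (Classical.choose h) else none
  have hQ : ∀ {E F : FundamentalExtension.{u}}, (E ≅ F) → Q E = Q F := by
    intro E F e; funext X; apply propext
    exact ⟨fun ⟨h, ⟨i⟩⟩ => ⟨h, ⟨e.symm ≪≫ i⟩⟩, fun ⟨h, ⟨i⟩⟩ => ⟨h, ⟨e ≪≫ i⟩⟩⟩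
  have choose_congr : ∀ (q₁ q₂ : M.Curve → Prop) (h₁ : ∃ x, q₁ x) (h₂ : ∃ x, q₂ x),
      q₁ = q₂ → Classical.choose h₁ = Classical.choose h₂ := by
    rintro q₁ q₂ h₁ h₂ rfl; rfl
  -- isomorphic extensions have the same reference input
  have hrep : ∀ {E F : FundamentalExtension.{u}}, (E ≅ F) → rep E = rep F := by
    intro E F e
    have hq := hQ e
    by_cases h : ∃ X, Q E X
    · have h' : ∃ X, Q F X := hq ▸ h
      simp only [rep, dif_pos h, dif_pos h', Option.some.injEq]
      exact choose_congr _ _ h h' hq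
    · have h' : ¬ ∃ X, Q F X := hq ▸ h
      simp only [rep, dif_neg h, dif_neg h']
  have rep_some : ∀ {E : FundamentalExtension.{u}} {X : M.Curve}, rep E = some X → Q E X := by
    intro E X h
    by_cases hE : ∃ X, Q E X
    · simp only [rep, dif_pos hE, Option.some.injEq] at h
      exact h ▸ Classical.choose_spec hE
    · simp [rep, dif_neg hE] at h
  have rep_eq_none : ∀ {E : FundamentalExtension.{u}}, rep E = none → ¬ ∃ X, Q E X := by
    intro E h hE; simp [rep, dif_pos hE] at h
  -- the output on an abstract extension, as a function of the reference input
  let objOf : ∀ (E : FundamentalExtension.{u}), Option M.Curve → MLFReconstruction E := fun E o =>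
    match o with
    | none =>
      { galCyclotome := PUnit
        arithCyclotome := PUnit
        cycloSync := AddEquiv.refl _
        frobQuot := 1
        H1 := (ULift.{u} ℚ)ˣ
        baseField := ULift.{u} ℚ
        kummerBase := MonoidHom.id _
        kummerBase_injective := fun _ _ h => h
        functionField := ULift.{u} ℚ
        closedPointDecomp := S E }
    | some X =>
      { galCyclotome := PUnit
        arithCyclotome := PUnit
        cycloSync := AddEquiv.refl _
        frobQuot := 1
        H1 := (M.base X)ˣ
        baseField := M.base X
        kummerBase := MonoidHom.id _
        kummerBase_injective := fun _ _ h => h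
        functionField := M.FunctionField X
        closedPointDecomp := S E }
  -- transport along an equality of reference inputs: casts
  let isoOfEq : ∀ (E F : FundamentalExtension.{u}) (o o' : Option M.Curve), o = o' →
      (objOf E o).Iso (objOf F o') := fun E F o o' h => by
    subst h
    cases o with
    | none => exact ⟨RingEquiv.refl _, RingEquiv.refl _, fun _ => rfl⟩
    | some X => exact ⟨RingEquiv.refl _, RingEquiv.refl _, fun _ => rfl⟩
  have isoOfEq_refl : ∀ (E : FundamentalExtension.{u}) (o : Option M.Curve) (h : o = o),
      (isoOfEq E E o o h).funEquiv = RingEquiv.refl _ := by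
    intro E o h
    cases o <;> rfl
  have isoOfEq_trans : ∀ (E F K : FundamentalExtension.{u}) (o o' o'' : Option M.Curve)
      (h : o = o') (h' : o' = o''),
      (isoOfEq E K o o'' (h.trans h')).funEquiv =
        (isoOfEq E F o o' h).funEquiv.trans (isoOfEq F K o' o'' h').funEquiv := by
    intro E F K o o' o'' h h'
    subst h; subst h'
    cases o <;> rfl
  have isoOfEq_symm_apply : ∀ (E F : FundamentalExtension.{u}) (o o' : Option M.Curve)
      (h : o = o') (h' : o' = o) (x : (objOf E o).functionField),
      (isoOfEq F E o' o h').funEquiv ((isoOfEq E F o o' h).funEquiv x) = x := by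
    intro E F o o' h h' x
    subst h
    cases o <;> rfl
  -- the function field of an input has characteristic zero
  have hchar : ∀ X : M.Curve, CharZero (M.FunctionField X) := fun X =>
    charZero_of_injective_algebraMap (algebraMap (M.base X) (M.FunctionField X)).injective
  -- transport along an open injective homomorphism, off the isomorphisms: by cases on the two
  -- reference inputs — (B2) between pinned classes, `ℚ → K` into a pinned class, vacuous (B4) out of one
  let comapOf : ∀ (E F : FundamentalExtension.{u}) (f : E ⟶ F), f.IsOpenInjective →
      ∀ (oE oF : Option M.Curve), rep E = oE → rep F = oF →
        ((objOf F oF).functionField →+* (objOf E oE).functionField) :=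
    fun E F f hf oE oF hE hF =>
    match oE, oF, hE, hF with
    | none, none, _, _ => RingHom.id _
    | some X, none, _, _ =>
        haveI := hchar X
        (algebraMap ℚ (M.FunctionField X)).comp (ULift.ringEquiv : ULift.{u} ℚ ≃+* ℚ).toRingHom
    | none, some Y, hE, hF =>
        False.elim <| by
          obtain ⟨hY, ⟨eY⟩⟩ := rep_some hF
          obtain ⟨X, hX, hXb, hiso⟩ := hCov E Y hY.1 hY.2 (f ≫ eY.hom)
            (hf.comp (FundamentalExtension.Hom.IsOpenInjective.of_iso eY))
          exact rep_eq_none hE ⟨X, ⟨hX, hXb⟩, hiso⟩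
    | some X, some Y, hE, hF =>
        Classical.choice <| by
          obtain ⟨hX, ⟨eX⟩⟩ := rep_some hE
          obtain ⟨hY, ⟨eY⟩⟩ := rep_some hF
          exact hHom X Y hX.1 hX.2 hY.1 hY.2 (eX.inv ≫ f ≫ eY.hom)
            (((FundamentalExtension.Hom.IsOpenInjective.of_iso eX.symm).comp hf).comp
              (FundamentalExtension.Hom.IsOpenInjective.of_iso eY))
  -- the algorithm record
  let A : MLFReconstructionAlgorithm.{u} :=
    { obj := fun E => objOf E (rep E)
      map := fun {E F} e => isoOfEq E F (rep E) (rep F) (hrep e)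
      map_id := fun E => isoOfEq_refl E (rep E) (hrep (Iso.refl E))
      map_comp := fun {E F K} e e' => by
        have h := isoOfEq_trans E F K (rep E) (rep F) (rep K) (hrep e) (hrep e')
        exact h
      comap := fun {E F} f hf =>
        if hI : IsIso f then
          (isoOfEq F E (rep F) (rep E) (hrep (asIso f)).symm).funEquiv.toRingHom
        else comapOf E F f hf (rep E) (rep F) rfl rfl
      comap_map := fun {E F} e h x => by
        have hI : IsIso e.hom := inferInstance
        simp only [dif_pos hI]
        exact isoOfEq_symm_apply E F (rep E) (rep F) (hrep e) (hrep (asIso e.hom)).symm x }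
  refine ⟨A, fun X hX hXb => ?_⟩
  -- the comparison at a pinned input `X`: (B1) between the chosen reference input `X₀` and `X`,
  -- and the point clause by (B3), after rewriting the reference input of `M.ext X` to `some X₀`
  have hpin : ∃ X₀, Q (M.ext X) X₀ := ⟨X, ⟨hX, hXb⟩, ⟨Iso.refl _⟩⟩
  have hrepX : rep (M.ext X) = some (Classical.choose hpin) := by simp only [rep, dif_pos hpin]
  obtain ⟨⟨hX₀, hX₀b⟩, ⟨e₀⟩⟩ := Classical.choose_spec hpin
  have key : ∀ (o : Option M.Curve) (X₀ : M.Curve), o = some X₀ → M.IsCor110Input X₀ →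
      M.IsStrictlyBelyiType X₀ → ∀ _ : M.ext X ≅ M.ext X₀,
      (∃ (eb : (objOf (M.ext X) o).baseField ≃+* M.base X)
        (ef : (objOf (M.ext X) o).functionField ≃+* M.FunctionField X),
        ∀ c, ef (algebraMap _ _ c) = algebraMap (M.base X) (M.FunctionField X) (eb c)) ∧
      (objOf (M.ext X) o).closedPointDecomp =
        {D | ∃ (x : M.Point X) (g : (M.ext X).arith), D = MulAut.conj g • M.decomp X x} := by
    intro o X₀ ho h₀ h₀b e
    subst ho
    exact ⟨hIso X₀ X h₀ h₀b hX hXb e.symm, (hS X hX hXb).symm⟩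
  exact key (rep (M.ext X)) (Classical.choose hpin) hrepX hX₀ hX₀b e₀

/-- **The typed row is bi-anabelian modulo model closure**: at an interface `M` satisfying the
closure law (B4) (`hCov`: abstract extensions with an open injective homomorphism into the extension of
a strictly-Belyi MLF input are themselves isomorphic to such an extension), the instance form
`Cor_1_10_iii M` is EQUIVALENT to the conjunction of (B1) Isom-rigidity of the pairs `k ⊆ K_X`,
(B2) field embeddings along open injective homomorphisms, (B3) factorisation of the closed-point data
through `Π` — the forward implications being abc-iut-f-088's `Cor_1_10_iii.exists_ringEquiv_compatible`,
`Cor_1_10_iii.nonempty_ringHom_functionField_of_isOpenInjective`, `Cor_1_10_iii.exists_closedPointDecomp_eq`.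
So what a supplier of F-0396 at a genuine model must deliver is exactly the absolute bi-anabelian
rigidity of strictly-Belyi hyperbolic orbicurves over MLF's (Rmk. 1.9.8: "bi-anabelian ⟹? mono-anabelian").
[cite: MochizukiAbsTopIII2015, Cor 1.10 (iii) p.43] -/
theorem cor_1_10_iii_iff_biAnabelian
    (hCov : ∀ (E : FundamentalExtension.{u}) (Y : M.Curve), M.IsCor110Input Y →
      M.IsStrictlyBelyiType Y → ∀ f : E ⟶ M.ext Y, f.IsOpenInjective →
        ∃ X : M.Curve, M.IsCor110Input X ∧ M.IsStrictlyBelyiType X ∧ Nonempty (E ≅ M.ext X)) :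
    Cor_1_10_iii M ↔
      (∀ X Y : M.Curve, M.IsCor110Input X → M.IsStrictlyBelyiType X →
        M.IsCor110Input Y → M.IsStrictlyBelyiType Y → ∀ _ : M.ext X ≅ M.ext Y,
        ∃ (eb : M.base X ≃+* M.base Y) (ef : M.FunctionField X ≃+* M.FunctionField Y),
          ∀ c, ef (algebraMap (M.base X) (M.FunctionField X) c) =
            algebraMap (M.base Y) (M.FunctionField Y) (eb c)) ∧
      (∀ X Y : M.Curve, M.IsCor110Input X → M.IsStrictlyBelyiType X →
        M.IsCor110Input Y → M.IsStrictlyBelyiType Y → ∀ f : M.ext X ⟶ M.ext Y, f.IsOpenInjective →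
        Nonempty (M.FunctionField Y →+* M.FunctionField X)) ∧
      (∃ S : ∀ E : FundamentalExtension.{u}, Set (Subgroup E.arith),
        ∀ X : M.Curve, M.IsCor110Input X → M.IsStrictlyBelyiType X →
          {D | ∃ (x : M.Point X) (g : (M.ext X).arith), D = MulAut.conj g • M.decomp X x} =
            S (M.ext X)) :=
  ⟨fun h => ⟨fun _ _ hX hXb hY hYb e => h.exists_ringEquiv_compatible hX hXb hY hYb e,
    fun _ _ hX hXb hY hYb f hf => h.nonempty_ringHom_functionField_of_isOpenInjective hX hXb hY hYb f hf,
    h.exists_closedPointDecomp_eq⟩,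
   fun ⟨hIso, hHom, hPt⟩ => cor_1_10_iii_of_biAnabelian M hIso hHom hPt hCov⟩

end AbsTopIII

end Literature.AnabelianGeometry.AbsoluteAnabelian

end
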